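import Summits.QuantumAdvantage.QuantumAdvantage.Theses.CompactnessLift
import Summits.QuantumAdvantage.QuantumAdvantage.Theorems.CompactnessLiftLanguageLadderSummitStrength
import Literature.Computability.Complexity.RelativizedTime
import Literature.Computability.Complexity.ProbabilisticClassesProofs
import Literature.Computability.QuantumComplexity.BQTime
import Literature.Computability.QuantumComplexity.BQPSubsetPP
import Literature.Computability.QuantumComplexity.OracleSeparationsProofs
import Literature.Computability.Cryptography.ClassBQPProofs
import Literature.Barriers.QuantumAdvantage.SeparationPrerequisitesProofs

/-!
# BC2-REDIRECT census for the crux `LanguageLadder` (stmt-QuantumAdvantage-15271, route CompactnessLift)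
# — kernel-checked companion of `STRATEGY-CENSUS.md` (seat planner-cstrat-stmt-QuantumAdvantage-15271-r1-0, 2026-08-17)

Question put to this seat (re-audit bin RESTATED, human ruling 2026-08-16 21:1x CDT): does the deciding crux
`LanguageLadder` (as typed ⟺ the summit in the quadratic-padding window — a LANDED theorem,
`Theorems.CompactnessLiftLanguageLadder.quantumAdvantage_of_languageLadder` /
`languageLadder_iff_not_BQTime_two_subset_BPP`) admit a typed decomposition `X₁ ∧ … ∧ X_k → LanguageLadder`
with (a) k ≥ 2 load-bearing pieces, (b) the assembly PROVED, (c) no piece giving the Statement or the crux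
on its own (cheap probes fail, no landed iff, no summit-equivalence), (d) every OPEN piece planned
(registered skeleton or live line)?

This file TYPES every candidate split against the REAL route decls and PROVES every assembly (so (a)/(b)
are settled here by the kernel), and proves the logical facts the census uses to decide (c)/(d).
The cheap probes themselves are in the sibling files `bc/Probes1.lean`, `bc/Probes2.lean` (they must FAIL,
so they cannot live in an rc-0 file). Nothing here is sorried; every folklore Turing-machine construction
the tree lacks is an explicit NAMED hypothesis (`QuadPadding`, `BPPCovered`), never assumed globally.

Sections: §0 the crux as typed (landed facts recalled) · §1 Δ1 = the thesis-faithful bridge split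
`FineLadder ∧ UniformExponent` · §2 the (d)-analysis of Δ1 (why `FineLadder` has only summit skeletons;
why every skeleton of `UniformExponent` has an open stub equivalent to it) · §3 Δ21 witness-route launder ·
§4 Δ24 derandomised witness split · §5 Δ19 oracle removal · §6 Δ11 counting cases · §7 Δ10 the
all-of-BQP bridge · §8 Δ16 deterministic ladder.
-/

set_option linter.dupNamespace false

namespace Summit.QuantumAdvantage.QuantumAdvantage.Cruxes.LanguageLadder.Redirect

open Literature.Computability.Complexity Literature.Computability.QuantumComplexity
  Literature.Computability.Cryptography
open Summit.QuantumAdvantage.QuantumAdvantage.Theses.CompactnessLift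
open Summit.QuantumAdvantage.QuantumAdvantage.Theorems.CompactnessLiftLanguageLadder

/-! ## §0 The crux as typed — landed facts (recalled by name, nothing re-proved) -/

/-- LANDED: the typed crux is exactly `¬ (BQTIME(n²) ⊆ BPP)`. -/
example : LanguageLadder ↔ ¬ (BQTime (fun n => n ^ 2) ⊆ BPP) :=
  languageLadder_iff_not_BQTime_two_subset_BPP

/-- LANDED: the typed crux implies the summit (BC2 probe `C → S` is a ONE-LEMMA `exact`). -/
example : LanguageLadder → _root_.QuantumAdvantage :=
  quantumAdvantage_of_languageLadder

/-- The typed crux in witness form: ONE quadratic-time-uniform Clifford+T language outside `BPP`. -/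
theorem languageLadder_iff_exists_not_mem_BPP :
    LanguageLadder ↔ ∃ L ∈ BQTime (fun n => n ^ 2), L ∉ BPP := by
  rw [languageLadder_iff_not_BQTime_two_subset_BPP, Set.not_subset]

/-- **Quadratic padding** (folklore TM2 construction, NOT in the tree; it is the route's open support
item `SummitGivesLadder` (stmt-15274) in repaired form): a `BQP ∖ BPP` witness pads into `BQTIME(n²) ∖ BPP`.
Explicit hypothesis wherever used. -/
def QuadPadding : Prop :=
  _root_.QuantumAdvantage → ∃ L ∈ BQTime (fun n => n ^ 2), L ∉ BPP

/-- Modulo quadratic padding the typed crux IS the summit (both directions). -/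
theorem languageLadder_iff_summit (hpad : QuadPadding) : LanguageLadder ↔ _root_.QuantumAdvantage :=
  ⟨quantumAdvantage_of_languageLadder, fun hS => languageLadder_iff_exists_not_mem_BPP.2 (hpad hS)⟩

/-- **Coin splitting** `BPP ⊆ ⋃ k, BPTIME(n^k)` (Arora–Barak Def. 7.2 `⊆`; folklore TM2 construction, NOT
in the tree — `RelativizedTime.lean` "Not here"). Explicit hypothesis wherever used. -/
def BPPCovered : Prop :=
  BPP ⊆ ⋃ k : ℕ, BPTime (fun n => n ^ k)

/-! ## §1 Δ1 — the thesis-faithful split `LanguageLadder ⇐ FineLadder ∧ UniformExponent`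

The route's thesis is `S ⇐ ¬UC ∧ CP`; typed honestly (over `BPTime`, as every prior seat asked) and taken
one level down — under `LanguageLadder ≡ S_quad := ¬ (BQTIME(n²) ⊆ BPP)` — it reads
`S_quad ⇐ FineLadder ∧ UniformExponent`. -/

/-- **Piece X₁ (`FineLadder`, = the refuter's repaired crux LL′ verbatim):** fine-grained quantum advantage
at every polynomial rung — for every `c` some quadratic-time-uniform Clifford+T language lies outside
honest `BPTIME(n^c)` (`O(n^c)` coins, inner machine linear in the padded input). Open; hypothesis-type. -/
def FineLadder : Prop :=
  ∀ c : ℕ, ∃ L ∈ BQTime (fun n => n ^ 2), L ∉ BPTime (fun n => n ^ c)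

/-- **Piece X₂ (`UniformExponent`, the compactness principle in the quadratic window, CP″):** if every
quadratic-time-uniform quantum language dequantizes at all, ONE classical exponent serves them all. Open. -/
def UniformExponent : Prop :=
  BQTime (fun n => n ^ 2) ⊆ BPP → ∃ c : ℕ, BQTime (fun n => n ^ 2) ⊆ BPTime (fun n => n ^ c)

/-- **(b) Assembly of Δ1, PROVED (trivial seam: three lines of logic over the landed iff).** -/
theorem languageLadder_of_fineLadder_of_uniformExponent
    (h₁ : FineLadder) (h₂ : UniformExponent) : LanguageLadder := by
  refine languageLadder_iff_not_BQTime_two_subset_BPP.2 fun hsub => ?_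
  obtain ⟨c, hc⟩ := h₂ hsub
  obtain ⟨L, hL, hLc⟩ := h₁ c
  exact hLc (hc hL)

/-- Curried form with the name the `--split` glue would carry. -/
theorem LanguageLadder_of_subs : FineLadder → UniformExponent → LanguageLadder :=
  languageLadder_of_fineLadder_of_uniformExponent

/-- Δ1 is a BRIDGE split: `UniformExponent` is exactly `FineLadder → LanguageLadder`. -/
theorem uniformExponent_iff_bridge : UniformExponent ↔ (FineLadder → LanguageLadder) := by
  constructor
  · exact fun h₂ h₁ => languageLadder_of_fineLadder_of_uniformExponent h₁ h₂
  · intro h hsub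
    by_contra hno
    push Not at hno
    have hfl : FineLadder := fun c => by
      obtain ⟨L, hL, hLc⟩ := Set.not_subset.1 (hno c)
      exact ⟨L, hL, hLc⟩
    exact (languageLadder_iff_not_BQTime_two_subset_BPP.1 (h hfl)) hsub

/-- (c)-bookkeeping, converse direction: the crux implies piece X₁ UNCONDITIONALLY (so `S → X₁` modulo
quadratic padding: X₁ is a consequence of the summit, used toward it only together with X₂). -/
theorem fineLadder_of_languageLadder (h : LanguageLadder) : FineLadder := by
  obtain ⟨L, hL, hB⟩ := languageLadder_iff_exists_not_mem_BPP.1 h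
  exact fun c => ⟨L, hL, fun hc => hB (BPTime_pow_subset_BPP c hc)⟩

/-- … and the crux implies piece X₂ (vacuously: its hypothesis is `¬ LanguageLadder`). -/
theorem uniformExponent_of_languageLadder (h : LanguageLadder) : UniformExponent :=
  fun hsub => absurd hsub (languageLadder_iff_not_BQTime_two_subset_BPP.1 h)

/-- So BOTH pieces are consequences of the summit modulo quadratic padding … -/
theorem pieces_of_summit (hpad : QuadPadding) (hS : _root_.QuantumAdvantage) :
    FineLadder ∧ UniformExponent :=
  let hL := (languageLadder_iff_summit hpad).2 hS
  ⟨fineLadder_of_languageLadder hL, uniformExponent_of_languageLadder hL⟩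

/-- … and jointly equivalent to it: Δ1 is the generic pattern `S ⟺ (¬S → Q) ∧ (¬S → ¬Q)` with
`Q :=` "a uniform classical exponent for `BQTIME(n²)`". The two halves, spelled as conditionals on the
collapse: -/
theorem fineLadder_iff_collapse_imp_noUniformExponent :
    FineLadder ↔ (BQTime (fun n => n ^ 2) ⊆ BPP →
      ∀ c : ℕ, ¬ BQTime (fun n => n ^ 2) ⊆ BPTime (fun n => n ^ c)) := by
  constructor
  · intro h _ c hc
    obtain ⟨L, hL, hLc⟩ := h c
    exact hLc (hc hL)
  · intro h c
    by_cases hsub : BQTime (fun n => n ^ 2) ⊆ BPP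
    · obtain ⟨L, hL, hLc⟩ := Set.not_subset.1 (h hsub c)
      exact ⟨L, hL, hLc⟩
    · obtain ⟨L, hL, hB⟩ := Set.not_subset.1 hsub
      exact ⟨L, hL, fun hc => hB (BPTime_pow_subset_BPP c hc)⟩

theorem uniformExponent_iff_collapse_imp_uniformExponent :
    UniformExponent ↔ (BQTime (fun n => n ^ 2) ⊆ BPP →
      ∃ c : ℕ, BQTime (fun n => n ^ 2) ⊆ BPTime (fun n => n ^ c)) :=
  Iff.rfl

/-! ## §2 The (d)-analysis of Δ1

### §2.1 `FineLadder` has only summit-strength skeletons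

Every skeleton that CONSTRUCTS the rung witnesses from one explicit object is a proof of the summit
(Ideator-2 B1, `Cruxes/LanguageLadder/Ideator2Notes.lean`: computably witnessed ladder ⟺ S mod folklore).
The two concrete skeleton shapes available on the hub, with the exact point where each becomes `S`: -/

/-- Shape W (witness transport from a live witness route — e.g. ArithStatLadder's `IqThreeMemBQP` /
`IqThreeNotBPP`, Shor's FACTORING): stubs `L₀ ∈ BQP`, `L₀ ∉ BPP`, `QuadPadding`. They do give X₁ … -/
theorem fineLadder_of_witness (hpad : QuadPadding) {L₀ : Language Bool} (hq : L₀ ∈ BQP)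
    (hB : L₀ ∉ BPP) : FineLadder :=
  (pieces_of_summit hpad ⟨L₀, hq, hB⟩).1

/-- … because the two hardness/membership stubs ARE the summit in one anonymous-constructor step
(this is `ArithStatLadder.closes` / `Shor`'s assembly verbatim): shape W is an S-proof followed by padding,
not a plan for X₁. -/
theorem summit_of_witness {L₀ : Language Bool} (hq : L₀ ∈ BQP) (hB : L₀ ∉ BPP) :
    _root_.QuantumAdvantage :=
  ⟨L₀, hq, hB⟩

/-- Shape W′ (one padded witness serving every rung: stubs `L₀ ∈ BQTIME(n²)`, `∀ c, L₀ ∉ BPTIME(n^c)`):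
the second stub alone is the summit modulo coin splitting. -/
theorem summit_of_paddedWitness (hcov : BPPCovered) {L₀ : Language Bool}
    (hq : L₀ ∈ BQTime (fun n => n ^ 2)) (hhard : ∀ c : ℕ, L₀ ∉ BPTime (fun n => n ^ c)) :
    _root_.QuantumAdvantage := by
  refine ⟨L₀, BQTime_pow_subset_BQP 2 hq, fun hB => ?_⟩
  obtain ⟨k, hk⟩ := Set.mem_iUnion.1 (hcov hB)
  exact hhard k hk

/-- Shape R (rung-by-rung): any finite set of rungs is NOT X₁ — the rungs are monotone, so X₁ is
equivalent to each of its tails (`Disproof.lean` §3 for the typed ladder; here for X₁, modulo the folklore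
coin-truncation monotonicity `BPTimeMono`). Hence a skeleton with finitely many rung stubs must contain a
tail stub, which is X₁ again (costume). -/
def BPTimeMono : Prop :=
  ∀ c c' : ℕ, c ≤ c' → BPTime (fun n => n ^ c) ⊆ BPTime (fun n => n ^ c')

theorem fineLadder_iff_tail (hmono : BPTimeMono) (c₀ : ℕ) :
    FineLadder ↔ ∀ c : ℕ, c₀ ≤ c → ∃ L ∈ BQTime (fun n => n ^ 2), L ∉ BPTime (fun n => n ^ c) := by
  refine ⟨fun h c _ => h c, fun h c => ?_⟩
  obtain ⟨L, hL, hLc⟩ := h (max c c₀) (le_max_right _ _)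
  exact ⟨L, hL, fun hc => hLc (hmono c (max c c₀) (le_max_left _ _) hc)⟩

/-! ### §2.2 Every skeleton of `UniformExponent` has an open stub equivalent to it

The route's own plan for the lift (T1, Schöning–Ladner uniform diagonalization; sibling census
`Cruxes/CompactnessPrinciple/STRATEGY-CENSUS.md` §4 D1) is `Selection ∧ UnifDiag`. For ANY proposition `W`
standing for "the ladder is computably witnessed" (however the tree will eventually type machine codes),
write the two stubs parametrically: -/

/-- `Selection W`: in the collapse world, if the fine ladder holds then it is `W`-witnessed (OPEN). -/
def Selection (W : Prop) : Prop :=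
  BQTime (fun n => n ^ 2) ⊆ BPP → FineLadder → W

/-- `UnifDiag W`: a `W`-witnessed ladder merges into ONE quadratic-uniform language outside `BPP`
(THEOREM-TYPE for the honest machine-code `W`: delayed diagonalization / clocked universal simulation,
XL; trivial for Ideator-2's `ComputablyWitnessedLadder`, which bakes the merge into `UniversalFor`). -/
def UnifDiag (W : Prop) : Prop :=
  W → ∃ U ∈ BQTime (fun n => n ^ 2), U ∉ BPP

/-- The skeleton composes (so it is admissible mechanically) … -/
theorem uniformExponent_of_selection_of_unifDiag {W : Prop} (hsel : Selection W) (hud : UnifDiag W) :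
    UniformExponent := by
  intro hsub
  by_contra hno
  push Not at hno
  have hfl : FineLadder := fun c => by
    obtain ⟨L, hL, hLc⟩ := Set.not_subset.1 (hno c)
    exact ⟨L, hL, hLc⟩
  obtain ⟨U, hU, hUB⟩ := hud (hsel hsub hfl)
  exact hUB (hsub hU)

/-- … but its open stub is implied by the piece FOR EVERY `W` (the hypotheses of `Selection` contradict
`UniformExponent`), so `Selection W ⟺ UniformExponent` modulo the theorem-type stub `UnifDiag W`: the
skeleton isolates the recursion-theoretic content but does not reduce it — "a line for Selection is a line
for CP″" (sibling census §4 D1, now uniform in the choice of `W`). -/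
theorem selection_of_uniformExponent (W : Prop) (h : UniformExponent) : Selection W := by
  intro hsub hfl
  obtain ⟨c, hc⟩ := h hsub
  obtain ⟨L, hL, hLc⟩ := hfl c
  exact absurd (hc hL) hLc

theorem selection_iff_uniformExponent {W : Prop} (hud : UnifDiag W) : Selection W ↔ UniformExponent :=
  ⟨fun hsel => uniformExponent_of_selection_of_unifDiag hsel hud, selection_of_uniformExponent W⟩

/-- The same for the sibling's other theorem-type lever (counting cases, census §4 Dε):
`PPCollapseUniform ∧ (PP ⊄ BPP → UniformExponent)`; the open half is the piece minus a disbelieved world. -/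
def PPCollapseUniform : Prop :=
  PP ⊆ BPP → ∃ c : ℕ, BQTime (fun n => n ^ 2) ⊆ BPTime (fun n => n ^ c)

theorem uniformExponent_of_ppCases (h₁ : PPCollapseUniform) (h₂ : ¬ (PP ⊆ BPP) → UniformExponent) :
    UniformExponent := by
  by_cases hPP : PP ⊆ BPP
  · exact fun _ => h₁ hPP
  · exact h₂ hPP

theorem ppCase_of_uniformExponent (h : UniformExponent) : ¬ (PP ⊆ BPP) → UniformExponent := fun _ => h

/-! ## §3 Δ21 — the witness-route launder `IqThreeMemBQP ∧ IqThreeNotBPP ∧ QuadPadding`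

Stated for an arbitrary witness `L₀` (ArithStatLadder: `L₀ = IQ3`; Shor: FACTORING). It passes the LETTER
of (a)–(d) (three pieces, assembly below, no piece alone gives S or the crux, both hard pieces have live
lines on route ArithStatLadder) and is rejected because the first two pieces are ANOTHER ROUTE's `closes`
(`summit_of_witness`): the "decomposition" is `S`, then padding. -/

theorem languageLadder_of_witnessRoute (hpad : QuadPadding) {L₀ : Language Bool} (h₁ : L₀ ∈ BQP)
    (h₂ : L₀ ∉ BPP) : LanguageLadder :=
  (languageLadder_iff_summit hpad).2 (summit_of_witness h₁ h₂)

/-! ## §4 Δ24 — the derandomised witness split `QuadNotP ∧ DerandWindow`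

Trade the randomized lower bound for a deterministic one plus derandomization:
`S_quad ⇐ (BQTIME(n²) ⊄ P) ∧ (BPP = P on BQTIME(n²))`. Both pieces natural, neither a consequence of the
other, X₄₂ NOT implied by S; each has a Wiles-shaped sub-plan bottoming out in a famous CLASSICAL
conjecture (FACTORING ∉ P + Shor; E ⊄ io-SIZE(2^{εn}) + Impagliazzo–Wigderson). Rejected for THIS unit only
because it is not a decomposition of the compactness thesis but a re-derivation of S through the
Shor/CircuitLB witness family (an alternative decomposition of S = a separate route; `no_new_routes`). -/

/-- X₄₁: some quadratic-time-uniform quantum language is not in deterministic `P`. -/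
def QuadNotP : Prop :=
  ∃ L ∈ BQTime (fun n => n ^ 2), L ∉ Classes.P

/-- X₄₂: `BPP = P` on the quadratic quantum window (implied by `BPP ⊆ P`). -/
def DerandWindow : Prop :=
  ∀ L ∈ BQTime (fun n => n ^ 2), L ∈ BPP → L ∈ Classes.P

/-- (b) Assembly of Δ24, PROVED. -/
theorem languageLadder_of_quadNotP_of_derandWindow (h₁ : QuadNotP) (h₂ : DerandWindow) :
    LanguageLadder := by
  obtain ⟨L, hL, hP⟩ := h₁
  exact languageLadder_iff_exists_not_mem_BPP.2 ⟨L, hL, fun hB => hP (h₂ L hL hB)⟩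

/-- X₄₂ from the textbook conjecture `BPP = P` (one inclusion suffices). -/
theorem derandWindow_of_BPP_subset_P (h : BPP ⊆ Classes.P) : DerandWindow := fun _ _ hB => h hB

/-- X₄₁ is a consequence of the crux (hence of S mod padding), via the tree theorem `P ⊆ BPP`. -/
theorem quadNotP_of_languageLadder (h : LanguageLadder) : QuadNotP := by
  obtain ⟨L, hL, hB⟩ := languageLadder_iff_exists_not_mem_BPP.1 h
  exact ⟨L, hL, fun hP => hB (P_subset_BPP_holds hP)⟩

/-- X₄₁'s own Wiles-shaped plan: a padded explicit problem in `BQTIME(n²)` (Shor-type membership,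
theorem-type) that is not in `P` (classical conjecture, e.g. FACTORING ∉ FP) — and this pair is NOT the
summit: it gives only `BQP ≠ P`-type content. -/
theorem quadNotP_of_detWitness {L₀ : Language Bool} (hq : L₀ ∈ BQTime (fun n => n ^ 2))
    (hP : L₀ ∉ Classes.P) : QuadNotP :=
  ⟨L₀, hq, hP⟩

/-! ## §5 Δ19 — oracle removal `RelSep ∧ (RelSep → LanguageLadder)`

`RelSep` is a tree THEOREM (`exists_oracle_BQPRel_not_subset_BPPRel_holds`, Raz–Tal), so the bridge is
LITERALLY equivalent to the crux: "T proved ⇒ (T → X) ≡ X" made concrete. And unlike Ribet ⇒ FLT, no proof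
of the crux would consume `RelSep` (oracle instantiation is the RandomOracleMethod heuristic, not a lemma). -/

theorem oracleRemovalBridge_iff :
    (exists_oracle_BQPRel_not_subset_BPPRel → LanguageLadder) ↔ LanguageLadder :=
  ⟨fun h => h exists_oracle_BQPRel_not_subset_BPPRel_holds, fun h _ => h⟩

/-! ## §6 Δ11 — counting cases `(PP ⊆ BPP → LL) ∧ (PP ⊄ BPP → LL)`

The first conjunct is just `PP ⊄ BPP` (the SeparationPrerequisites floor, a consequence of S); the second
is the crux minus a disbelieved world, with no mechanism feeding on `PP ⊄ BPP`. -/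

theorem ppCollapseCase_iff :
    (PP ⊆ BPP → LanguageLadder) ↔ ¬ (PP ⊆ BPP) := by
  constructor
  · intro h hPP
    exact Literature.Barriers.QuantumAdvantage.not_summit_of_PP_subset_BPP' hPP
      (quantumAdvantage_of_languageLadder (h hPP))
  · exact fun h hPP => absurd hPP h

theorem languageLadder_of_ppCases (h₁ : PP ⊆ BPP → LanguageLadder) (h₂ : ¬ (PP ⊆ BPP) → LanguageLadder) :
    LanguageLadder := by
  by_cases hPP : PP ⊆ BPP
  · exact h₁ hPP
  · exact h₂ hPP

/-! ## §7 Δ10 — the all-of-`BQP` bridge `W ∧ (W → LL)`, `W := ∀ c, BQP ⊄ BPTIME(n^c)`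

`W` has a classical plan (it follows from `∀ c, P ⊄ BPTIME(n^c)` since `P ⊆ BQP`), but the bridge's
contrapositive derives from `¬LL` a uniform randomized exponent for ALL OF `BQP ⊇ P`, i.e. the disbelieved
`∃ c, P ⊆ BPTIME(n^c)`: the bridge holds only because its conclusion does — no mechanism. -/

def NoFixedExponentBQP : Prop :=
  ∀ c : ℕ, ¬ (BQP ⊆ BPTime (fun n => n ^ c))

theorem noFixedExponentBQP_of_classical (h : ∀ c : ℕ, ¬ (Classes.P ⊆ BPTime (fun n => n ^ c))) :
    NoFixedExponentBQP :=
  fun c hc => h c fun _ hL => hc (P_subset_BQP_holds hL)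

theorem languageLadder_of_allBQPBridge (h₁ : NoFixedExponentBQP) (h₂ : NoFixedExponentBQP → LanguageLadder) :
    LanguageLadder :=
  h₂ h₁

/-- What the bridge asserts in the collapse world: a fixed randomized exponent for all of `P`. -/
theorem allBQPBridge_contrapositive (h₂ : NoFixedExponentBQP → LanguageLadder) (hno : ¬ LanguageLadder) :
    ∃ c : ℕ, Classes.P ⊆ BPTime (fun n => n ^ c) := by
  by_contra hP
  push Not at hP
  refine hno (h₂ (noFixedExponentBQP_of_classical fun c hc => ?_))
  obtain ⟨L, hL, hLc⟩ := Set.not_subset.1 (hP c)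
  exact hLc (hc hL)

/-! ## §8 Δ16 — deterministic ladder `FineLadderD ∧ UniformExponentD ∧ DerandWindow`

Three phenomena separated (quantum-vs-deterministic rungs, compactness, derandomization); the assembly is
proved, but the tail of `FineLadderD` is `BQP ≠ P`-strength and `UniformExponentD` has the same planless
selection residue as `UniformExponent`. -/

def FineLadderD : Prop :=
  ∀ c : ℕ, ∃ L ∈ BQTime (fun n => n ^ 2), L ∉ DTIME (fun n => n ^ c)

def UniformExponentD : Prop :=
  BQTime (fun n => n ^ 2) ⊆ Classes.P → ∃ c : ℕ, BQTime (fun n => n ^ 2) ⊆ DTIME (fun n => n ^ c)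

theorem languageLadder_of_detLadder (h₁ : FineLadderD) (h₂ : UniformExponentD) (h₃ : DerandWindow) :
    LanguageLadder := by
  refine languageLadder_iff_not_BQTime_two_subset_BPP.2 fun hsub => ?_
  have hP : BQTime (fun n => n ^ 2) ⊆ Classes.P := fun L hL => h₃ L hL (hsub hL)
  obtain ⟨c, hc⟩ := h₂ hP
  obtain ⟨L, hL, hLc⟩ := h₁ c
  exact hLc (hc hL)

end Summit.QuantumAdvantage.QuantumAdvantage.Cruxes.LanguageLadder.Redirect
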